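import Literature.NumberTheory.EllipticCurves.KatzPAdicLFunctionCMFieldLocalDataDyadicUnitProofs
import HarnessLib

set_option linter.dupNamespace false -- `Summit.BirchSwinnertonDyer.BirchSwinnertonDyer.Theorems.…` (summit = sub, D-0017)
set_option autoImplicit false

/-!
# Crux `EisensteinHeartFlatCMInertBadKPrime` (stmt-BirchSwinnertonDyer-21341), line `hsieh-lambda`, layer 2:
# Hsieh's `ϑ` at the biquadratic frame `L = K′(√d_CM)` — (d1), Σ-positivity and (d2) DISCHARGED

Route `BiquadraticEisensteinDescent` (cell `pub/bsd-wall`, width seat `bsd-wall-cm-bed-w2` g7; the LEAD's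
«WIDTH CYCLE 3 (2): (d2) ϑ by CRT», card `Cruxes/EisensteinHeartFlatCMInertBadKPrime/Lines/hsieh-lambda.md`
v2.1; memo `INSTANTIATION-L-BIQUADRATIC.md` §ADDENDUM 3). THEOREMS ONLY (no definition, no named fact, no
`sorry`). BSD is not proved by any of this; nothing here asserts the crux's input.

THE FACT'S HYPOTHESES. The Katz existence fact of the V2 socket
(`Literature.….hsieh2014mu_prop49_exists_isMeasure` / `KatzCM.exists_isBaseChangeLine`) asks for `ϑ ∈ L`
with (d1) `Re σ(ϑ) = 0` for every `σ : L →+* ℂ`, `Im σ(ϑ) > 0` for `σ ∈ Σ`, and (d2)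
`ordAt w (2ϑ) = differentExponentAt w` for every `w` in the finite set `D ⊇ {w ∣ p} ∪ S ∪ cS`. At the
route's frame (`K = K′` the Heegner field, `L = K(x)`, `x² = d = d_CM ∈ {−3, −4, −7, −8, −11, −19, −43,
−67, −163}`, every prime `ℓ ∣ pN_W` NOT dividing `d_{K′}` — the Heegner hypothesis and `p` split) this
file PRODUCES such a `ϑ`, EXPLICITLY (no approximation theorem, no CRT):

  `ϑ := (a·y + b·x)/2`, `y = √d_{K′} ∈ K′` (`y² = d_{K′}`), `b := ∏_{ℓ ∈ P, ℓ ∤ d} ℓ · 2^{[d = −4]}`,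
  `a := a₀·(1 + k·M)`, `a₀ := ∏_{ℓ ∈ P, ℓ odd, ℓ ∣ d} ℓ · 2^{[d = −4]} · 4^{[d = −8]}`, `M := 2·∏_{ℓ ∈ P, ℓ ∤ d} ℓ`,
  `k ≫ 0`,

for ANY finite set `P` of primes not dividing `d_{K′}` (the consumer takes the prime divisors of `pN_W`).
Then, by the five cells of `Literature/…/KatzPAdicLFunctionCMFieldLocalData{Recipe,DyadicUnit}Proofs`
(unit `ℓ ∤ 2d` / dyadic unit `ℓ = 2 ∤ d` / tame odd `ℓ ∣ d` / dyadic `d = −4` / dyadic `d = −8`):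

* `exists_theta` — **∃ ϑ : L with (d1), with `Im σ(ϑ) > 0` for every `σ` restricting to `φ̄₀` on `K′`
  (the Σ of `…SigmaOrientation.inSigma_singleton_iff`, `y` oriented by `Im φ₀(y) < 0`), and with (d2) at
  EVERY prime `w` of `L` above a prime of `P`.**
* `cmDiscr_props` — the four arithmetic properties of the nine CM discriminants used (negative; odd ⟹
  `≡ 1 (mod 4)`; odd part square-free; even ⟹ `∈ {−4, −8}`), so `exists_theta_of_mem` takes `d` from the
  explicit list.

What is NOT here (next tranche): the hypothesis `hD₄` of the fact («every prime ramified in `L/L⁺` lies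
in `D`») — at the frame `L/L⁺` is unramified at all finite primes (genus theory for coprime `d_CM`,
`d_{K′}`), to be landed separately; the `S/T` bookkeeping; (T), (L) (w3/w4 seats).
-/

noncomputable section

open scoped nonZeroDivisors NumberField

namespace Summit.BirchSwinnertonDyer.BirchSwinnertonDyer.Theorems.BiquadraticEisensteinDescentEisensteinHeartFlatCMInertBadKPrimeTheta

open NumberField IsDedekindDomain Literature.NumberTheory.EllipticCurves

variable {K : Type} [Field K] [NumberField K] (L : Type) [Field L] [NumberField L] [Algebra K L]

/-! ## §1 Arithmetic of the recipe's integers `a`, `b` -/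

section Integers

/-- A product of primes is positive. [folklore] -/
private theorem prod_pos_of_prime {Q : Finset ℕ} (hQ : ∀ ℓ ∈ Q, ℓ.Prime) : 0 < ∏ ℓ ∈ Q, ℓ :=
  Finset.prod_pos fun ℓ hℓ ↦ (hQ ℓ hℓ).pos

/-- A prime divides a product of distinct primes iff it is one of them. [folklore] -/
private theorem prime_dvd_prod_iff {Q : Finset ℕ} (hQ : ∀ ℓ ∈ Q, ℓ.Prime) {q : ℕ} (hq : q.Prime) :
    q ∣ ∏ ℓ ∈ Q, ℓ ↔ q ∈ Q := by
  rw [Prime.dvd_finsetProd_iff hq.prime]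
  constructor
  · rintro ⟨ℓ, hℓ, hqℓ⟩
    rwa [(Nat.prime_dvd_prime_iff_eq hq (hQ ℓ hℓ)).mp hqℓ]
  · intro h; exact ⟨q, h, dvd_rfl⟩

end Integers

/-! ## §2 The theorem -/

/-- **Hsieh's `ϑ` at the biquadratic frame.** Let `K` be a number field with `y ∈ K`, `y² = d_K < 0`
(the Heegner field `K′` and `√d_{K′}`), `L = K(x)` with `[L:K] ≤ 2` and `x² = d` where `d < 0` is an
integer with: `d` odd ⟹ `d ≡ 1 (mod 4)`; the odd part of `d` square-free; `d` even ⟹ `d ∈ {−4, −8}` (the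
nine CM discriminants, `cmDiscr_props`); let `φ₀ : K →+* ℂ` with `Im φ₀(y) < 0`, and `P` a finite set of
primes none of which divides `d_K`. Then there is `ϑ ∈ L` with (d1) `Re σ(ϑ) = 0` for all `σ`, with
`Im σ(ϑ) > 0` whenever `σ|_K = φ̄₀`, and with (d2) `ordAt w (2ϑ) = differentExponentAt w` at every prime
`w` of `L` above a prime of `P`. [cite: Hsieh2014mu, §3.1 (d1) (d2)] -/
theorem exists_theta (h2 : Module.finrank K L ≤ 2) {x : L} {d : ℤ} (hgen : Algebra.adjoin K {x} = ⊤)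
    (hx : x ^ 2 = (d : L)) (hd0 : d < 0) (hd4 : ¬ (2 : ℤ) ∣ d → d % 4 = 1)
    (hdsq : ∀ ℓ : ℕ, ℓ.Prime → ℓ ≠ 2 → (ℓ : ℤ) ∣ d → ¬ ((ℓ : ℤ) ^ 2) ∣ d)
    (hdev : (2 : ℤ) ∣ d → d = -4 ∨ d = -8)
    {y : K} (hy : y ^ 2 = (NumberField.discr K : K)) (hdK : NumberField.discr K < 0)
    {φ₀ : K →+* ℂ} (hφ₀ : (φ₀ y).im < 0)
    (P : Finset ℕ) (hP : ∀ ℓ ∈ P, ℓ.Prime) (hPK : ∀ ℓ ∈ P, ¬ (ℓ : ℤ) ∣ NumberField.discr K) :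
    ∃ ϑ : L, (∀ σ : L →+* ℂ, (σ ϑ).re = 0) ∧
      (∀ σ : L →+* ℂ, σ.comp (algebraMap K L) = NumberField.ComplexEmbedding.conjugate φ₀ → 0 < (σ ϑ).im) ∧
      ∀ (w : HeightOneSpectrum (𝓞 L)) (ℓ : ℕ), ℓ ∈ P → ((ℓ : ℕ) : 𝓞 L) ∈ w.asIdeal →
        ordAt w (2 * ϑ) = differentExponentAt w := by
  classical
  -- the two prime sets and the integers `b`, `a₀`, `M`
  set Pu : Finset ℕ := P.filter (fun ℓ ↦ ¬ (ℓ : ℤ) ∣ d) with hPu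
  set Pt : Finset ℕ := P.filter (fun ℓ ↦ (ℓ : ℤ) ∣ d ∧ ℓ ≠ 2) with hPt
  have hPu_prime : ∀ ℓ ∈ Pu, ℓ.Prime := fun ℓ hℓ ↦ hP ℓ (Finset.mem_filter.mp hℓ).1
  have hPt_prime : ∀ ℓ ∈ Pt, ℓ.Prime := fun ℓ hℓ ↦ hP ℓ (Finset.mem_filter.mp hℓ).1
  set c₂ : ℕ := if d = -4 then 2 else 1 with hc₂
  set c₄ : ℕ := if d = -4 then 2 else if d = -8 then 4 else 1 with hc₄
  set bN : ℕ := (∏ ℓ ∈ Pu, ℓ) * c₂ with hbN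
  set a₀ : ℕ := (∏ ℓ ∈ Pt, ℓ) * c₄ with ha₀
  set M : ℕ := 2 * ∏ ℓ ∈ Pu, ℓ with hM
  have hbN_pos : 0 < bN := mul_pos (prod_pos_of_prime hPu_prime) (by rw [hc₂]; split_ifs <;> norm_num)
  have ha₀_pos : 0 < a₀ := mul_pos (prod_pos_of_prime hPt_prime) (by rw [hc₄]; split_ifs <;> norm_num)
  have hM_pos : 0 < M := mul_pos two_pos (prod_pos_of_prime hPu_prime)
  -- the archimedean size of `a`: `m := −Im φ₀(y) > 0`, want `a·m > bN·√(−d)`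
  set m : ℝ := -(φ₀ y).im with hm
  have hm_pos : 0 < m := by rw [hm]; linarith
  obtain ⟨k, hk⟩ := exists_nat_gt ((bN : ℝ) * Real.sqrt (-(d : ℝ)) / m)
  set aN : ℕ := a₀ * (1 + k * M) with haN
  -- the element
  set b : ℤ := (bN : ℤ) with hb
  set a : ℤ := (aN : ℤ) with ha
  refine ⟨((a : L) * algebraMap K L y + (b : L) * x) / 2, ?_, ?_, ?_⟩
  · -- (d1)
    intro σ
    exact re_apply_theta_eq_zero σ hx hd0.le (sq_algebraMap_eq_discr L hy) hdK.le a b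
  · -- Σ-positivity
    intro σ hσ
    refine im_apply_theta_pos_of_sq_eq σ hx hd0.le ?_
    have hY : (σ (algebraMap K L y)).im = m := by
      have : σ (algebraMap K L y) = NumberField.ComplexEmbedding.conjugate φ₀ y := by
        rw [← RingHom.comp_apply, hσ]
      rw [this, NumberField.ComplexEmbedding.conjugate_coe_eq, Complex.conj_im, hm]
    rw [hY]
    have ha1 : (k : ℝ) ≤ (a : ℝ) := by
      have hk1 : k ≤ aN := by
        rw [haN]
        calc k ≤ k * M := Nat.le_mul_of_pos_right k hM_pos
          _ ≤ 1 + k * M := Nat.le_add_left _ _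
          _ ≤ a₀ * (1 + k * M) := Nat.le_mul_of_pos_left _ ha₀_pos
      rw [ha]; exact_mod_cast hk1
    have hbabs : |(b : ℝ)| = (bN : ℝ) := by rw [hb]; push_cast; exact abs_of_nonneg (Nat.cast_nonneg _)
    rw [hbabs]
    rw [div_lt_iff₀ hm_pos] at hk
    calc (bN : ℝ) * Real.sqrt (-(d : ℝ)) < (k : ℝ) * m := hk
      _ ≤ (a : ℝ) * m := by gcongr
  · -- (d2), prime by prime
    intro w ℓ hℓP hw
    have hℓ : ℓ.Prime := hP ℓ hℓP
    have hℓK : ¬ (ℓ : ℤ) ∣ NumberField.discr K := hPK ℓ hℓP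
    -- casting of divisibilities to `ℕ`
    have cast_dvd : ∀ (m n : ℕ), ((m : ℤ) ∣ (n : ℤ)) ↔ m ∣ n := fun m n ↦ Int.natCast_dvd_natCast
    have hℓd_nat : ((ℓ : ℤ) ∣ d) ↔ ℓ ∣ d.natAbs := Int.natCast_dvd
    -- (F0) parities of the two prime products
    have hPt_odd : ¬ 2 ∣ ∏ ℓ ∈ Pt, ℓ := fun h ↦ by
      have := (prime_dvd_prod_iff hPt_prime Nat.prime_two).mp h
      exact (Finset.mem_filter.mp this).2.2 rfl
    have hkM_odd : ¬ 2 ∣ 1 + k * M := fun h ↦ by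
      have h2M : 2 ∣ k * M := Dvd.dvd.mul_left (dvd_mul_right 2 _) k
      have := (Nat.dvd_add_left h2M).mp h
      omega
    -- (F1) unit primes divide `b`
    have F1 : ¬ (ℓ : ℤ) ∣ d → (ℓ : ℤ) ∣ b := fun hℓd ↦ by
      have hmem : ℓ ∈ Pu := Finset.mem_filter.mpr ⟨hℓP, hℓd⟩
      rw [hb, hbN, cast_dvd]
      exact Dvd.dvd.mul_right (Finset.dvd_prod_of_mem _ hmem) _
    -- (F2) unit primes do not divide `a`
    have F2 : ¬ (ℓ : ℤ) ∣ d → ¬ (ℓ : ℤ) ∣ a := fun hℓd hdvd ↦ by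
      have hmem : ℓ ∈ Pu := Finset.mem_filter.mpr ⟨hℓP, hℓd⟩
      rw [ha, haN, cast_dvd] at hdvd
      have hℓM : ℓ ∣ k * M := Dvd.dvd.mul_left (Dvd.dvd.mul_left (Finset.dvd_prod_of_mem _ hmem) 2) k
      have hndvd : ¬ ℓ ∣ 1 + k * M := fun h ↦ hℓ.one_lt.ne' (Nat.dvd_one.mp ((Nat.dvd_add_left hℓM).mp h))
      have ha₀dvd : ℓ ∣ a₀ := ((Nat.Prime.dvd_mul hℓ).mp hdvd).resolve_right hndvd
      rw [ha₀] at ha₀dvd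
      rcases (Nat.Prime.dvd_mul hℓ).mp ha₀dvd with h | h
      · have := (prime_dvd_prod_iff hPt_prime hℓ).mp h
        exact hℓd (Finset.mem_filter.mp this).2.1
      · -- `ℓ ∣ c₄ ∈ {1, 2, 4}` forces `ℓ = 2` and `d ∈ {−4, −8}`, contradicting `ℓ ∤ d`
        rw [hc₄] at h
        split_ifs at h with h4 h8
        · exact hℓd (by rw [h4, (Nat.prime_dvd_prime_iff_eq hℓ Nat.prime_two).mp h]; norm_num)
        · have : ℓ = 2 := (Nat.prime_dvd_prime_iff_eq hℓ Nat.prime_two).mp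
            (hℓ.dvd_of_dvd_pow (n := 2) (by simpa using h))
          exact hℓd (by rw [h8, this]; norm_num)
        · exact hℓ.one_lt.ne' (Nat.dvd_one.mp h)
    -- (F3) tame primes divide `a`
    have F3 : (ℓ : ℤ) ∣ d → ℓ ≠ 2 → (ℓ : ℤ) ∣ a := fun hℓd hℓ2 ↦ by
      have hmem : ℓ ∈ Pt := Finset.mem_filter.mpr ⟨hℓP, hℓd, hℓ2⟩
      rw [ha, haN, cast_dvd]
      exact Dvd.dvd.mul_right (Dvd.dvd.mul_right (Finset.dvd_prod_of_mem _ hmem) _) _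
    -- (F4) tame primes do not divide `b`
    have F4 : (ℓ : ℤ) ∣ d → ℓ ≠ 2 → ¬ (ℓ : ℤ) ∣ b := fun hℓd hℓ2 hdvd ↦ by
      rw [hb, hbN, cast_dvd] at hdvd
      rcases (Nat.Prime.dvd_mul hℓ).mp hdvd with h | h
      · have := (prime_dvd_prod_iff hPu_prime hℓ).mp h
        exact (Finset.mem_filter.mp this).2 hℓd
      · rw [hc₂] at h
        split_ifs at h with h4
        · exact hℓ2 ((Nat.prime_dvd_prime_iff_eq hℓ Nat.prime_two).mp h)
        · exact hℓ.one_lt.ne' (Nat.dvd_one.mp h)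
    -- the five cells
    rw [mul_div_cancel₀ _ (two_ne_zero' L)]
    by_cases hℓd : (ℓ : ℤ) ∣ d
    · by_cases hℓ2 : ℓ = 2
      · subst hℓ2
        rcases hdev (by exact_mod_cast hℓd) with hd4' | hd8
        · -- `d = −4`: `2 ∥ a`, `2 ∣ b`
          have hx4 : x ^ 2 = -4 := by rw [hx, hd4']; norm_num
          have ha2 : (2 : ℤ) ∣ a := by
            rw [ha, haN, ha₀, hc₄, if_pos hd4', show (2 : ℤ) = ((2 : ℕ) : ℤ) from rfl, cast_dvd]
            exact Dvd.dvd.mul_right (dvd_mul_left 2 _) _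
          have ha4 : ¬ (2 : ℤ) ^ 2 ∣ a := by
            rw [ha, haN, ha₀, hc₄, if_pos hd4', show (2 : ℤ) ^ 2 = ((4 : ℕ) : ℤ) by norm_num, cast_dvd]
            intro h
            -- `4 ∣ (odd · 2) · odd` is impossible
            have h2 : 2 ∣ (∏ ℓ ∈ Pt, ℓ) * (1 + k * M) := by
              have : 2 * 2 ∣ ((∏ ℓ ∈ Pt, ℓ) * (1 + k * M)) * 2 := by
                calc 2 * 2 = 4 := by norm_num
                  _ ∣ (∏ ℓ ∈ Pt, ℓ) * 2 * (1 + k * M) := h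
                  _ = ((∏ ℓ ∈ Pt, ℓ) * (1 + k * M)) * 2 := by ring
              exact (Nat.mul_dvd_mul_iff_right two_pos).mp this
            rcases (Nat.Prime.dvd_mul Nat.prime_two).mp h2 with h' | h'
            · exact hPt_odd h'
            · exact hkM_odd h'
          have hb2 : (2 : ℤ) ∣ b := by
            rw [hb, hbN, hc₂, if_pos hd4', show (2 : ℤ) = ((2 : ℕ) : ℤ) from rfl, cast_dvd]
            exact dvd_mul_left 2 _
          exact hd2_dyadic_four L hx4 h2 hy w hw (by exact_mod_cast hℓK) ha2 ha4 hb2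
        · -- `d = −8`: `4 ∣ a`, `2 ∤ b`
          have hx8 : x ^ 2 = -8 := by rw [hx, hd8]; norm_num
          have hne4 : d ≠ -4 := by rw [hd8]; norm_num
          have ha4 : (2 : ℤ) ^ 2 ∣ a := by
            rw [ha, haN, ha₀, hc₄, if_neg hne4, if_pos hd8, show (2 : ℤ) ^ 2 = ((4 : ℕ) : ℤ) by norm_num, cast_dvd]
            exact Dvd.dvd.mul_right (dvd_mul_left 4 _) _
          have hb2 : ¬ (2 : ℤ) ∣ b := by
            rw [hb, hbN, hc₂, if_neg hne4, mul_one, show (2 : ℤ) = ((2 : ℕ) : ℤ) from rfl, cast_dvd]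
            intro h
            have := (prime_dvd_prod_iff hPu_prime Nat.prime_two).mp h
            exact (Finset.mem_filter.mp this).2 (by rw [hd8]; norm_num)
          exact hd2_dyadic_eight L hx8 h2 hy w hw (by exact_mod_cast hℓK) ha4 hb2
      · -- tame odd `ℓ ∣ d`
        exact hd2_tame L hx h2 hy hℓ hℓ2 w hw hℓd (hdsq ℓ hℓ hℓ2 hℓd) hℓK (F3 hℓd hℓ2) (F4 hℓd hℓ2)
    · by_cases hℓ2 : ℓ = 2
      · -- dyadic unit prime: `d` odd
        subst hℓ2
        exact hd2_dyadic_unit L hgen hx (hd4 (by exact_mod_cast hℓd)) hy w hw (by exact_mod_cast hℓK)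
          (by exact_mod_cast F2 hℓd) (by exact_mod_cast F1 hℓd)
      · -- unit prime `ℓ ∤ 2d`
        have h2d : ¬ (ℓ : ℤ) ∣ 2 * d := fun h ↦ by
          rcases (Nat.prime_iff_prime_int.mp hℓ).dvd_or_dvd h with h | h
          · exact hℓ2 ((Nat.prime_dvd_prime_iff_eq hℓ Nat.prime_two).mp (by exact_mod_cast h))
          · exact hℓd h
        exact hd2_unit L hgen hx hy hℓ w hw h2d hℓK (F2 hℓd) (F1 hℓd)

/-! ## §3 The nine CM discriminants satisfy the arithmetic hypotheses -/

/-- **The nine CM field discriminants `d ∈ {−3, −4, −7, −8, −11, −19, −43, −67, −163}`** (the discriminants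
of the imaginary quadratic orders' fields of the thirteen CM `j`-invariants over `ℚ`) are negative, `≡ 1
(mod 4)` when odd, have square-free odd part, and are `−4` or `−8` when even. [cite: SilvermanATAEC1994, App. A §3] -/
theorem cmDiscr_props {d : ℤ}
    (hd : d = -3 ∨ d = -4 ∨ d = -7 ∨ d = -8 ∨ d = -11 ∨ d = -19 ∨ d = -43 ∨ d = -67 ∨ d = -163) :
    d < 0 ∧ (¬ (2 : ℤ) ∣ d → d % 4 = 1) ∧
      (∀ ℓ : ℕ, ℓ.Prime → ℓ ≠ 2 → (ℓ : ℤ) ∣ d → ¬ ((ℓ : ℤ) ^ 2) ∣ d) ∧ ((2 : ℤ) ∣ d → d = -4 ∨ d = -8) := by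
  -- the odd values are (minus) primes: `ℓ ∣ −q` with `ℓ, q` prime forces `ℓ = q`, and `q² ∤ q`
  have hprime : ∀ q : ℕ, q.Prime → ∀ ℓ : ℕ, ℓ.Prime → (ℓ : ℤ) ∣ -(q : ℤ) → ¬ ((ℓ : ℤ) ^ 2) ∣ -(q : ℤ) := by
    intro q hq ℓ hℓ h1 h2
    have hℓq : ℓ = q := (Nat.prime_dvd_prime_iff_eq hℓ hq).mp (by exact_mod_cast (dvd_neg.mp h1))
    subst hℓq
    have : ℓ ^ 2 ∣ ℓ := by exact_mod_cast (dvd_neg.mp h2 : (ℓ : ℤ) ^ 2 ∣ (ℓ : ℤ))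
    have h := Nat.le_of_dvd hℓ.pos this
    nlinarith [hℓ.two_le]
  rcases hd with rfl | rfl | rfl | rfl | rfl | rfl | rfl | rfl | rfl
  · exact ⟨by norm_num, fun _ ↦ by decide, fun ℓ hℓ _ ↦ hprime 3 Nat.prime_three ℓ hℓ, fun h ↦ by norm_num at h⟩
  · refine ⟨by norm_num, fun h ↦ absurd (by norm_num) h, fun ℓ hℓ hℓ2 h ↦ ?_, fun _ ↦ Or.inl rfl⟩
    have : ℓ ∣ 2 ^ 2 := by exact_mod_cast (dvd_neg.mp h : (ℓ : ℤ) ∣ 4)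
    exact absurd ((Nat.prime_dvd_prime_iff_eq hℓ Nat.prime_two).mp (hℓ.dvd_of_dvd_pow this)) hℓ2
  · exact ⟨by norm_num, fun _ ↦ by decide, fun ℓ hℓ _ ↦ hprime 7 (by norm_num) ℓ hℓ, fun h ↦ by norm_num at h⟩
  · refine ⟨by norm_num, fun h ↦ absurd (by norm_num) h, fun ℓ hℓ hℓ2 h ↦ ?_, fun _ ↦ Or.inr rfl⟩
    have : ℓ ∣ 2 ^ 3 := by exact_mod_cast (dvd_neg.mp h : (ℓ : ℤ) ∣ 8)
    exact absurd ((Nat.prime_dvd_prime_iff_eq hℓ Nat.prime_two).mp (hℓ.dvd_of_dvd_pow this)) hℓ2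
  · exact ⟨by norm_num, fun _ ↦ by decide, fun ℓ hℓ _ ↦ hprime 11 (by norm_num) ℓ hℓ, fun h ↦ by norm_num at h⟩
  · exact ⟨by norm_num, fun _ ↦ by decide, fun ℓ hℓ _ ↦ hprime 19 (by norm_num) ℓ hℓ, fun h ↦ by norm_num at h⟩
  · exact ⟨by norm_num, fun _ ↦ by decide, fun ℓ hℓ _ ↦ hprime 43 (by norm_num) ℓ hℓ, fun h ↦ by norm_num at h⟩
  · exact ⟨by norm_num, fun _ ↦ by decide, fun ℓ hℓ _ ↦ hprime 67 (by norm_num) ℓ hℓ, fun h ↦ by norm_num at h⟩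
  · exact ⟨by norm_num, fun _ ↦ by decide, fun ℓ hℓ _ ↦ hprime 163 (by norm_num) ℓ hℓ, fun h ↦ by norm_num at h⟩

/-- **Hsieh's `ϑ` for `d` one of the nine CM discriminants** (the route's `d = cmFieldDiscrOfJ W.j`):
`exists_theta` with the arithmetic hypotheses discharged by `cmDiscr_props`. [cite: Hsieh2014mu, §3.1 (d1) (d2)] -/
theorem exists_theta_of_mem (h2 : Module.finrank K L ≤ 2) {x : L} {d : ℤ} (hgen : Algebra.adjoin K {x} = ⊤)
    (hx : x ^ 2 = (d : L))
    (hd : d = -3 ∨ d = -4 ∨ d = -7 ∨ d = -8 ∨ d = -11 ∨ d = -19 ∨ d = -43 ∨ d = -67 ∨ d = -163)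
    {y : K} (hy : y ^ 2 = (NumberField.discr K : K)) (hdK : NumberField.discr K < 0)
    {φ₀ : K →+* ℂ} (hφ₀ : (φ₀ y).im < 0)
    (P : Finset ℕ) (hP : ∀ ℓ ∈ P, ℓ.Prime) (hPK : ∀ ℓ ∈ P, ¬ (ℓ : ℤ) ∣ NumberField.discr K) :
    ∃ ϑ : L, (∀ σ : L →+* ℂ, (σ ϑ).re = 0) ∧
      (∀ σ : L →+* ℂ, σ.comp (algebraMap K L) = NumberField.ComplexEmbedding.conjugate φ₀ → 0 < (σ ϑ).im) ∧
      ∀ (w : HeightOneSpectrum (𝓞 L)) (ℓ : ℕ), ℓ ∈ P → ((ℓ : ℕ) : 𝓞 L) ∈ w.asIdeal →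
        ordAt w (2 * ϑ) = differentExponentAt w := by
  obtain ⟨hd0, hd4, hdsq, hdev⟩ := cmDiscr_props hd
  exact exists_theta L h2 hgen hx hd0 hd4 hdsq hdev hy hdK hφ₀ P hP hPK

end Summit.BirchSwinnertonDyer.BirchSwinnertonDyer.Theorems.BiquadraticEisensteinDescentEisensteinHeartFlatCMInertBadKPrimeTheta

end
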